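import Literature.NumberTheory.Rogawski1990.RankOneEulerPoincareNonsplit      -- ★ the letter (R2)
import HarnessLib

/-!
# (R2) riders: the rank-one Euler–Poincaré letter in the three shapes its consumers use

Topic `NumberTheory/Rogawski1990`; namespace `Literature.NumberTheory.Rogawski1990`.  KERNEL-lane file: theorems only (no definition, no instance, no notation, no
`sorry`), all pure logic ∕ `finsum` bookkeeping over the named fact ★ `RankOneEulerPoincareNonsplit` (taken as a HYPOTHESIS `h` — nothing here proves it).  Cell
`pub/hodgecm-mathlib`, line «N6nsGerm», binder (Iε′) of the (S1) junction; seat B-p08 (g27).  HC_CM is proved only modulo the printed citations until rung 0 closes.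

* `RankOneEulerPoincareNonsplit.exists_orbitalIntegral_eq_ite` — one-clause form `Φ(⟦γ⟧, f) = if Z(γ) compact then 1 else 0` (classical `ite`).
* `RankOneEulerPoincareNonsplit.exists_classOrbitalIntegral_out` — the same read at the representative `Quotient.out c` of a regular class `c` (the convention of ★ `IsCanonical`).
* `RankOneEulerPoincareNonsplit.exists_stableOrbitalIntegralRel_eq_ncard` — for ANY relation `st`: if every class `st`-related to `γ` is regular and elliptic, `Φ^{st}(γ, f)` is the
  NUMBER of such classes; if every such class is regular and non-elliptic, `Φ^{st}(γ, f) = 0` (the weighted form «`N(T)·𝟙_ell`» the (S1) junction's ε′-side produces).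

References: [Kottwitz1988] §2 Thm. 2; [Rogawski1990] §12.6 p. 174, §8.1 Prop. 8.1.3.
-/

noncomputable section

open NumberField IsDedekindDomain MeasureTheory Measure
open Literature.NumberTheory.Automorphic
open scoped Matrix MatrixGroups

namespace Literature.NumberTheory.Rogawski1990

/-- `ConjClasses.mk (out c) = c`. [folklore] -/
private theorem conjClasses_mk_out {G : Type*} [Monoid G] (c : ConjClasses G) : ConjClasses.mk (Quotient.out c) = c := by
  rw [← ConjClasses.quotient_mk_eq_mk, Quotient.out_eq]

namespace RankOneEulerPoincareNonsplit

/-- **One-clause form**: under (R2), there is `f ∈ C_c^∞(U(Φ₂)_v)` with `Φ(⟦γ⟧, f) = if (Z(γ) compact) then 1 else 0` at every regular `γ`.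
[cite: Rogawski1990, §12.6 p. 174] [cite: Kottwitz1988, §2 Theorem 2] -/
theorem exists_orbitalIntegral_eq_ite (h : RankOneEulerPoincareNonsplit)
    (L : Type) [Field L] [NumberField L] [IsCMField L] (v : HeightOneSpectrum (𝓞 ↥(maximalRealSubfield L)))
  (hv : Subsingleton (UnitaryGroup.PlacesOver L v))
  [MeasurableSpace ((UnitaryGroup.cmDatum L 2 (Matrix.of fun i j : Fin 2 => if i.val + j.val + 1 = 2 then (1 : L) else 0)).Local v)]
  [BorelSpace ((UnitaryGroup.cmDatum L 2 (Matrix.of fun i j : Fin 2 => if i.val + j.val + 1 = 2 then (1 : L) else 0)).Local v)]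
  (ν : Measure ((UnitaryGroup.cmDatum L 2 (Matrix.of fun i j : Fin 2 => if i.val + j.val + 1 = 2 then (1 : L) else 0)).Local v))
  [ν.IsHaarMeasure] [ν.IsMulRightInvariant]
  [∀ γ : (UnitaryGroup.cmDatum L 2 (Matrix.of fun i j : Fin 2 => if i.val + j.val + 1 = 2 then (1 : L) else 0)).Local v,
    MeasurableSpace (((UnitaryGroup.cmDatum L 2 (Matrix.of fun i j : Fin 2 => if i.val + j.val + 1 = 2 then (1 : L) else 0)).Local v) ⧸
      Subgroup.centralizer ({γ} : Set ((UnitaryGroup.cmDatum L 2 (Matrix.of fun i j : Fin 2 => if i.val + j.val + 1 = 2 then (1 : L) else 0)).Local v)))]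
  [∀ γ : (UnitaryGroup.cmDatum L 2 (Matrix.of fun i j : Fin 2 => if i.val + j.val + 1 = 2 then (1 : L) else 0)).Local v,
    BorelSpace (((UnitaryGroup.cmDatum L 2 (Matrix.of fun i j : Fin 2 => if i.val + j.val + 1 = 2 then (1 : L) else 0)).Local v) ⧸
      Subgroup.centralizer ({γ} : Set ((UnitaryGroup.cmDatum L 2 (Matrix.of fun i j : Fin 2 => if i.val + j.val + 1 = 2 then (1 : L) else 0)).Local v)))]
  {m : OrbitalMeasureFamily ((UnitaryGroup.cmDatum L 2 (Matrix.of fun i j : Fin 2 => if i.val + j.val + 1 = 2 then (1 : L) else 0)).Local v)}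
  (hm : m.IsCanonical (fun γ => IsRegularElt (γ.val : GL (Fin 2) (UnitaryGroup.LocalRing L v))) ν) :
    ∃ f : (UnitaryGroup.cmDatum L 2 (Matrix.of fun i j : Fin 2 => if i.val + j.val + 1 = 2 then (1 : L) else 0)).Local v → ℂ, IsLocSmooth f ∧
      ∀ γ : (UnitaryGroup.cmDatum L 2 (Matrix.of fun i j : Fin 2 => if i.val + j.val + 1 = 2 then (1 : L) else 0)).Local v,
        IsRegularElt (γ.val : GL (Fin 2) (UnitaryGroup.LocalRing L v)) →
        classOrbitalIntegral m f (ConjClasses.mk γ) =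
          @ite ℂ (CompactSpace (Subgroup.centralizer ({γ} : Set ((UnitaryGroup.cmDatum L 2 (Matrix.of fun i j : Fin 2 => if i.val + j.val + 1 = 2 then (1 : L) else 0)).Local v))))
            (Classical.dec _) 1 0 := by
  obtain ⟨f, hf, h1, h0⟩ := h L v hv ν m hm
  refine ⟨f, hf, fun γ hγ => ?_⟩
  by_cases hc : CompactSpace (Subgroup.centralizer ({γ} : Set ((UnitaryGroup.cmDatum L 2 (Matrix.of fun i j : Fin 2 => if i.val + j.val + 1 = 2 then (1 : L) else 0)).Local v)))
  · rw [if_pos hc]; exact h1 γ hγ hc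
  · rw [if_neg hc]; exact h0 γ hγ hc

/-- **At representatives**: under (R2), one `f` serves every regular class `c`, read at `Quotient.out c` (★ `IsCanonical`'s convention): `Φ(c, f) = 1` if
`Z(out c)` is compact, `0` if not. [cite: Rogawski1990, §12.6 p. 174] [cite: Kottwitz1988, §2 Theorem 2] -/
theorem exists_classOrbitalIntegral_out (h : RankOneEulerPoincareNonsplit)
    (L : Type) [Field L] [NumberField L] [IsCMField L] (v : HeightOneSpectrum (𝓞 ↥(maximalRealSubfield L)))
  (hv : Subsingleton (UnitaryGroup.PlacesOver L v))
  [MeasurableSpace ((UnitaryGroup.cmDatum L 2 (Matrix.of fun i j : Fin 2 => if i.val + j.val + 1 = 2 then (1 : L) else 0)).Local v)]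
  [BorelSpace ((UnitaryGroup.cmDatum L 2 (Matrix.of fun i j : Fin 2 => if i.val + j.val + 1 = 2 then (1 : L) else 0)).Local v)]
  (ν : Measure ((UnitaryGroup.cmDatum L 2 (Matrix.of fun i j : Fin 2 => if i.val + j.val + 1 = 2 then (1 : L) else 0)).Local v))
  [ν.IsHaarMeasure] [ν.IsMulRightInvariant]
  [∀ γ : (UnitaryGroup.cmDatum L 2 (Matrix.of fun i j : Fin 2 => if i.val + j.val + 1 = 2 then (1 : L) else 0)).Local v,
    MeasurableSpace (((UnitaryGroup.cmDatum L 2 (Matrix.of fun i j : Fin 2 => if i.val + j.val + 1 = 2 then (1 : L) else 0)).Local v) ⧸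
      Subgroup.centralizer ({γ} : Set ((UnitaryGroup.cmDatum L 2 (Matrix.of fun i j : Fin 2 => if i.val + j.val + 1 = 2 then (1 : L) else 0)).Local v)))]
  [∀ γ : (UnitaryGroup.cmDatum L 2 (Matrix.of fun i j : Fin 2 => if i.val + j.val + 1 = 2 then (1 : L) else 0)).Local v,
    BorelSpace (((UnitaryGroup.cmDatum L 2 (Matrix.of fun i j : Fin 2 => if i.val + j.val + 1 = 2 then (1 : L) else 0)).Local v) ⧸
      Subgroup.centralizer ({γ} : Set ((UnitaryGroup.cmDatum L 2 (Matrix.of fun i j : Fin 2 => if i.val + j.val + 1 = 2 then (1 : L) else 0)).Local v)))]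
  {m : OrbitalMeasureFamily ((UnitaryGroup.cmDatum L 2 (Matrix.of fun i j : Fin 2 => if i.val + j.val + 1 = 2 then (1 : L) else 0)).Local v)}
  (hm : m.IsCanonical (fun γ => IsRegularElt (γ.val : GL (Fin 2) (UnitaryGroup.LocalRing L v))) ν) :
    ∃ f : (UnitaryGroup.cmDatum L 2 (Matrix.of fun i j : Fin 2 => if i.val + j.val + 1 = 2 then (1 : L) else 0)).Local v → ℂ, IsLocSmooth f ∧
      (∀ c : ConjClasses ((UnitaryGroup.cmDatum L 2 (Matrix.of fun i j : Fin 2 => if i.val + j.val + 1 = 2 then (1 : L) else 0)).Local v),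
          IsRegularElt ((Quotient.out c).val : GL (Fin 2) (UnitaryGroup.LocalRing L v)) →
          CompactSpace (Subgroup.centralizer ({Quotient.out c} : Set ((UnitaryGroup.cmDatum L 2 (Matrix.of fun i j : Fin 2 => if i.val + j.val + 1 = 2 then (1 : L) else 0)).Local v))) →
          classOrbitalIntegral m f c = 1) ∧
      (∀ c : ConjClasses ((UnitaryGroup.cmDatum L 2 (Matrix.of fun i j : Fin 2 => if i.val + j.val + 1 = 2 then (1 : L) else 0)).Local v),
          IsRegularElt ((Quotient.out c).val : GL (Fin 2) (UnitaryGroup.LocalRing L v)) →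
          ¬ CompactSpace (Subgroup.centralizer ({Quotient.out c} : Set ((UnitaryGroup.cmDatum L 2 (Matrix.of fun i j : Fin 2 => if i.val + j.val + 1 = 2 then (1 : L) else 0)).Local v))) →
          classOrbitalIntegral m f c = 0) := by
  obtain ⟨f, hf, h1, h0⟩ := h L v hv ν m hm
  refine ⟨f, hf, fun c hc hZ => ?_, fun c hc hZ => ?_⟩
  · have := h1 (Quotient.out c) hc hZ
    rwa [conjClasses_mk_out] at this
  · have := h0 (Quotient.out c) hc hZ
    rwa [conjClasses_mk_out] at this

/-- **Weighted ∕ stable form**: under (R2), one `f` has, for EVERY relation `st` on `U(Φ₂)_v` and every `γ`: if the set of classes `st`-related to `γ` is finite and each of them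
is regular with compact centraliser then `Φ^{st}(γ, f)` is the NUMBER of those classes (`N(T)` for the stable class of an elliptic regular `γ`); if each of them is regular with
non-compact centraliser then `Φ^{st}(γ, f) = 0`. [cite: Rogawski1990, §12.6 p. 174; §8.1 Prop. 8.1.3 pp. 109–111] [cite: Kottwitz1988, §2 Theorem 2] -/
theorem exists_stableOrbitalIntegralRel_eq_ncard (h : RankOneEulerPoincareNonsplit)
    (L : Type) [Field L] [NumberField L] [IsCMField L] (v : HeightOneSpectrum (𝓞 ↥(maximalRealSubfield L)))
  (hv : Subsingleton (UnitaryGroup.PlacesOver L v))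
  [MeasurableSpace ((UnitaryGroup.cmDatum L 2 (Matrix.of fun i j : Fin 2 => if i.val + j.val + 1 = 2 then (1 : L) else 0)).Local v)]
  [BorelSpace ((UnitaryGroup.cmDatum L 2 (Matrix.of fun i j : Fin 2 => if i.val + j.val + 1 = 2 then (1 : L) else 0)).Local v)]
  (ν : Measure ((UnitaryGroup.cmDatum L 2 (Matrix.of fun i j : Fin 2 => if i.val + j.val + 1 = 2 then (1 : L) else 0)).Local v))
  [ν.IsHaarMeasure] [ν.IsMulRightInvariant]
  [∀ γ : (UnitaryGroup.cmDatum L 2 (Matrix.of fun i j : Fin 2 => if i.val + j.val + 1 = 2 then (1 : L) else 0)).Local v,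
    MeasurableSpace (((UnitaryGroup.cmDatum L 2 (Matrix.of fun i j : Fin 2 => if i.val + j.val + 1 = 2 then (1 : L) else 0)).Local v) ⧸
      Subgroup.centralizer ({γ} : Set ((UnitaryGroup.cmDatum L 2 (Matrix.of fun i j : Fin 2 => if i.val + j.val + 1 = 2 then (1 : L) else 0)).Local v)))]
  [∀ γ : (UnitaryGroup.cmDatum L 2 (Matrix.of fun i j : Fin 2 => if i.val + j.val + 1 = 2 then (1 : L) else 0)).Local v,
    BorelSpace (((UnitaryGroup.cmDatum L 2 (Matrix.of fun i j : Fin 2 => if i.val + j.val + 1 = 2 then (1 : L) else 0)).Local v) ⧸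
      Subgroup.centralizer ({γ} : Set ((UnitaryGroup.cmDatum L 2 (Matrix.of fun i j : Fin 2 => if i.val + j.val + 1 = 2 then (1 : L) else 0)).Local v)))]
  {m : OrbitalMeasureFamily ((UnitaryGroup.cmDatum L 2 (Matrix.of fun i j : Fin 2 => if i.val + j.val + 1 = 2 then (1 : L) else 0)).Local v)}
  (hm : m.IsCanonical (fun γ => IsRegularElt (γ.val : GL (Fin 2) (UnitaryGroup.LocalRing L v))) ν) :
    ∃ f : (UnitaryGroup.cmDatum L 2 (Matrix.of fun i j : Fin 2 => if i.val + j.val + 1 = 2 then (1 : L) else 0)).Local v → ℂ, IsLocSmooth f ∧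
      (∀ (st : (UnitaryGroup.cmDatum L 2 (Matrix.of fun i j : Fin 2 => if i.val + j.val + 1 = 2 then (1 : L) else 0)).Local v →
          (UnitaryGroup.cmDatum L 2 (Matrix.of fun i j : Fin 2 => if i.val + j.val + 1 = 2 then (1 : L) else 0)).Local v → Prop)
        (γ : (UnitaryGroup.cmDatum L 2 (Matrix.of fun i j : Fin 2 => if i.val + j.val + 1 = 2 then (1 : L) else 0)).Local v),
        {c : ConjClasses ((UnitaryGroup.cmDatum L 2 (Matrix.of fun i j : Fin 2 => if i.val + j.val + 1 = 2 then (1 : L) else 0)).Local v) | st γ (Quotient.out c)}.Finite →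
        (∀ c : ConjClasses ((UnitaryGroup.cmDatum L 2 (Matrix.of fun i j : Fin 2 => if i.val + j.val + 1 = 2 then (1 : L) else 0)).Local v), st γ (Quotient.out c) →
          IsRegularElt ((Quotient.out c).val : GL (Fin 2) (UnitaryGroup.LocalRing L v)) ∧
          CompactSpace (Subgroup.centralizer ({Quotient.out c} : Set ((UnitaryGroup.cmDatum L 2 (Matrix.of fun i j : Fin 2 => if i.val + j.val + 1 = 2 then (1 : L) else 0)).Local v)))) →
        stableOrbitalIntegralRel st m f γ =
          ({c : ConjClasses ((UnitaryGroup.cmDatum L 2 (Matrix.of fun i j : Fin 2 => if i.val + j.val + 1 = 2 then (1 : L) else 0)).Local v) | st γ (Quotient.out c)}.ncard : ℂ)) ∧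
      (∀ (st : (UnitaryGroup.cmDatum L 2 (Matrix.of fun i j : Fin 2 => if i.val + j.val + 1 = 2 then (1 : L) else 0)).Local v →
          (UnitaryGroup.cmDatum L 2 (Matrix.of fun i j : Fin 2 => if i.val + j.val + 1 = 2 then (1 : L) else 0)).Local v → Prop)
        (γ : (UnitaryGroup.cmDatum L 2 (Matrix.of fun i j : Fin 2 => if i.val + j.val + 1 = 2 then (1 : L) else 0)).Local v),
        (∀ c : ConjClasses ((UnitaryGroup.cmDatum L 2 (Matrix.of fun i j : Fin 2 => if i.val + j.val + 1 = 2 then (1 : L) else 0)).Local v), st γ (Quotient.out c) →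
          IsRegularElt ((Quotient.out c).val : GL (Fin 2) (UnitaryGroup.LocalRing L v)) ∧
          ¬ CompactSpace (Subgroup.centralizer ({Quotient.out c} : Set ((UnitaryGroup.cmDatum L 2 (Matrix.of fun i j : Fin 2 => if i.val + j.val + 1 = 2 then (1 : L) else 0)).Local v)))) →
        stableOrbitalIntegralRel st m f γ = 0) := by
  obtain ⟨f, hf, h1, h0⟩ := exists_classOrbitalIntegral_out h L v hv ν hm
  refine ⟨f, hf, fun st γ hfin hall => ?_, fun st γ hall => ?_⟩
  · rw [stableOrbitalIntegralRel_def, finsum_mem_eq_finite_toFinset_sum _ hfin,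
      Finset.sum_congr rfl (fun c hc => h1 c (hall c (hfin.mem_toFinset.1 hc)).1 (hall c (hfin.mem_toFinset.1 hc)).2),
      Finset.sum_const, nsmul_eq_mul, mul_one, Set.ncard_eq_toFinset_card _ hfin]
  · rw [stableOrbitalIntegralRel_def]
    exact finsum_mem_of_eqOn_zero fun c hc => h0 c (hall c hc).1 (hall c hc).2

end RankOneEulerPoincareNonsplit

end Literature.NumberTheory.Rogawski1990

end
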